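import Mathlib.Data.Complex.Basic
import Summits.ValiantsHypothesis.ValiantsHypothesis.Theorems.DetQPDetqpThesisChowRankDegreeFloor
import Summits.ValiantsHypothesis.ValiantsHypothesis.Theorems.DetQPDetqpThesisStubDcPerPolyLeDcHyperdet

/-!
# `DetqpThesis` (stmt-ValiantsHypothesis-0315), line `chow-rank-ladder` — the Kumar–Volk rung
# (`stub_kvRung`) at rank one: `dc (P n 1) = 2n` exactly, so a witness needs `r ≥ 2`

The rank-`r` permanent is `P n r := per_n (U Vᵀ)`, the generic permanent `perPoly (Fin n) ℂ` with
`x_{ij}` replaced by `Σ_a U_{ia} V_{ja}` (`U_{ia} = X (inl (i, a))`, `V_{ja} = X (inr (j, a))`;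
`2nr` variables, degree `2n`).  The KUMAR–VOLK RUNG of the line (`stub_kvRung`, registered, open)
asks for ONE fixed rank `r ≥ 1` and a constant `k ≥ 1` with `(k + 1) · 2nr ≤ k · dc (P n r)` for
all large `n` — a determinantal-complexity lower bound exceeding the number of variables `2nr` by
the constant factor `1 + 1/k` (the type of Kumar–Volk, *A lower bound on determinantal
complexity*, comput. complex. 31 (2022), arXiv:2009.02452, Thm. 1: `dc (Σᵢ xᵢⁿ) ≥ 1.5n - 3` for
`n ≥ 6`, the only bound in print beyond the number of variables for an explicit polynomial; its
method rests on the singular locus of `Σᵢ xᵢⁿ` being the origin, whereas `Sing (P n r)` contains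
`{U has two zero rows}`, of codimension `2r` independent of `n`).

This file settles the bottom of the range of `r` unconditionally:

* `permanent_of_mul_eq`: the permanent of a rank-one matrix `(uᵢ vⱼ)ᵢⱼ` is `|ι|! · Πᵢ uᵢ · Πⱼ vⱼ`;
* `rankPer_one_eq`: hence `P n 1 = n! · Πᵢ U_{i0} · Πⱼ V_{j0}`, a monomial of degree `2n` up to
  the unit `n!` of `ℂ`;
* `hasDetRepr_rankPer_one`: the diagonal matrix `diag (U_{00}, …, U_{n-1,0}, V_{00}, …, V_{n-1,0})`
  with its first row multiplied by `n!` is an affine determinantal representation of `P n 1` of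
  size `2n`, so `dc (P n 1) ≤ 2n` (`dc_rankPer_one_le`); with the degree floor `2n ≤ dc (P n r)`
  (`ChowRankDegreeFloor.two_mul_le_dc_rankPer`) this gives `dc (P n 1) = 2n` (`dc_rankPer_one`);
* `not_kvRung_rank_one`: consequently the rung inequality `(k + 1) · 2n ≤ k · dc (P n 1)` FAILS at
  rank one for every `k` and every `n ≥ 1`, and every witness `(r, k, n₀)` of `stub_kvRung` has
  `2 ≤ r` (`two_le_of_kvRung`).  At `r = 2` the window is `2n ≤ dc (P n 2) ≤ n² + 2n`
  (degree floor; coefficient ABP of width `n + 1` with `(n+1)²` vertices), and the rung asks for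
  `(1 + 1/k) · 4n` — beyond the ceilings of the Mignon–Ressayre Hessian bound
  (`≤ #vars / 2 = 2n`) and of Alper–Bogart–Velasco (`dc ≥ codim Sing + 1`, here `≤ 2r + 1 = 5`);
  no engine in the tree reaches it.

Sources: T. Mignon, N. Ressayre, *A quadratic bound for the determinant and permanent problem*,
Int. Math. Res. Not. 2004:79, §1 (affine determinantal complexity; `deg f ≤ dc f`); H. Minc,
*Permanents*, Encyclopedia Math. Appl. 6 (1978), §2.1 (the permanent is multilinear in the rows,
`per (uvᵀ) = n! Π uᵢ Π vⱼ`); M. Kumar, B. L. Volk, comput. complex. 31 (2022), Thm. 1; folklore.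
-/

-- single-conjunct layout: Sub = Summit, duplicated namespace component intended
set_option linter.dupNamespace false

noncomputable section

namespace Summit.ValiantsHypothesis.ValiantsHypothesis.Theorems.DetQPDetqpThesis.ChowRankKvRung

open MvPolynomial
open Literature.Computability.AlgebraicComplexity
open Summit.ValiantsHypothesis.ValiantsHypothesis.Theorems.DetQPDetqpThesis.ChowRankDegreeFloor
  (two_mul_le_dc_rankPer)

/-- The permanent of a rank-one matrix `(uᵢ vⱼ)ᵢⱼ` is `|ι|! · Πᵢ uᵢ · Πⱼ vⱼ`: every one of the
`|ι|!` permutations contributes the same product (Minc 1978, §2.1). [folklore] -/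
theorem permanent_of_mul_eq {ι R : Type*} [Fintype ι] [DecidableEq ι] [CommSemiring R]
    (u v : ι → R) :
    (Matrix.of fun i j => u i * v j).permanent
      = (Fintype.card ι).factorial • ((∏ i, u i) * ∏ j, v j) := by
  unfold Matrix.permanent
  have h : ∀ σ : Equiv.Perm ι,
      ∏ i, (Matrix.of fun i j => u i * v j) (σ i) i = (∏ i, u i) * ∏ j, v j := fun σ => by
    simp only [Matrix.of_apply, Finset.prod_mul_distrib]
    rw [Equiv.prod_comp σ u]
  simp_rw [h]
  rw [Finset.sum_const, Finset.card_univ, Fintype.card_perm]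

/-- The rank-one permanent is the monomial `P n 1 = n! · Πᵢ U_{i0} · Πⱼ V_{j0}`: substituting
`x_{ij} ↦ U_{i0} V_{j0}` into the generic permanent gives the permanent of the rank-one matrix
`(U_{i0} V_{j0})ᵢⱼ` (Bürgisser 2000, (2.2); `permanent_of_mul_eq`). [folklore] -/
theorem rankPer_one_eq (n : ℕ) :
    aeval (fun x : Fin n × Fin n => ∑ a : Fin 1,
      (X (Sum.inl (x.1, a)) * X (Sum.inr (x.2, a)) :
        MvPolynomial ((Fin n × Fin 1) ⊕ (Fin n × Fin 1)) ℂ))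
      (perPoly (Fin n) ℂ)
    = C (n.factorial : ℂ) *
        ((∏ i : Fin n,
            (X (Sum.inl (i, 0)) : MvPolynomial ((Fin n × Fin 1) ⊕ (Fin n × Fin 1)) ℂ)) *
          ∏ j : Fin n,
            (X (Sum.inr (j, 0)) : MvPolynomial ((Fin n × Fin 1) ⊕ (Fin n × Fin 1)) ℂ)) := by
  have h : aeval (fun x : Fin n × Fin n => ∑ a : Fin 1,
      (X (Sum.inl (x.1, a)) * X (Sum.inr (x.2, a)) :
        MvPolynomial ((Fin n × Fin 1) ⊕ (Fin n × Fin 1)) ℂ)) (perPoly (Fin n) ℂ)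
      = (Matrix.of fun i j : Fin n =>
          (X (Sum.inl (i, (0 : Fin 1))) * X (Sum.inr (j, (0 : Fin 1))) :
            MvPolynomial ((Fin n × Fin 1) ⊕ (Fin n × Fin 1)) ℂ)).permanent := by
    simp [perPoly, Matrix.permanent, map_sum, map_prod]
  rw [h, permanent_of_mul_eq, Fintype.card_fin, nsmul_eq_mul, map_natCast]

/-- The product of the `2n` variables `Πᵢ U_{i0} · Πⱼ V_{j0}` is the determinant of the diagonal
matrix `diag (U_{00}, …, U_{n-1,0}, V_{00}, …, V_{n-1,0})` of size `n + n`, whose entries are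
variables or `0` (`Matrix.det_diagonal`; Mignon–Ressayre 2004, §1). [folklore] -/
theorem hasDetRepr_prod_X (n : ℕ) :
    HasDetRepr
      ((∏ i : Fin n,
          (X (Sum.inl (i, 0)) : MvPolynomial ((Fin n × Fin 1) ⊕ (Fin n × Fin 1)) ℂ)) *
        ∏ j : Fin n,
          (X (Sum.inr (j, 0)) : MvPolynomial ((Fin n × Fin 1) ⊕ (Fin n × Fin 1)) ℂ))
      (n + n) := by
  let d : Fin n ⊕ Fin n → MvPolynomial ((Fin n × Fin 1) ⊕ (Fin n × Fin 1)) ℂ :=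
    Sum.elim (fun i => X (Sum.inl (i, 0))) (fun j => X (Sum.inr (j, 0)))
  refine ⟨Matrix.diagonal (d ∘ finSumFinEquiv.symm), fun i j => ?_, ?_⟩
  · rw [Matrix.diagonal_apply]
    split_ifs
    · rcases h : finSumFinEquiv.symm i with a | b
      · simp only [Function.comp_apply, h, d, Sum.elim_inl]
        exact (totalDegree_X _).le
      · simp only [Function.comp_apply, h, d, Sum.elim_inr]
        exact (totalDegree_X _).le
    · simp
  · rw [Matrix.det_diagonal]
    simp only [Function.comp_apply]
    rw [Equiv.prod_comp finSumFinEquiv.symm d, Fintype.prod_sum_type]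
    simp [d]

/-- **`dc (P n 1) ≤ 2n`.**  `P n 1 = n! · Πᵢ U_{i0} Πⱼ V_{j0}` (`rankPer_one_eq`) is the determinant
of the diagonal matrix of the `2n` variables with its first row multiplied by the constant `n!`
(`hasDetRepr_prod_X`, `hasDetRepr_C_mul`); for `n = 0` both sides are the empty determinant `1`.
Mignon–Ressayre 2004, §1. [folklore] -/
theorem hasDetRepr_rankPer_one (n : ℕ) :
    HasDetRepr (aeval (fun x : Fin n × Fin n => ∑ a : Fin 1,
      (X (Sum.inl (x.1, a)) * X (Sum.inr (x.2, a)) :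
        MvPolynomial ((Fin n × Fin 1) ⊕ (Fin n × Fin 1)) ℂ))
      (perPoly (Fin n) ℂ)) (n + n) := by
  rw [rankPer_one_eq]
  rcases Nat.eq_zero_or_pos n with rfl | hn
  · simpa using hasDetRepr_prod_X 0
  · exact hasDetRepr_C_mul _ (by omega) (hasDetRepr_prod_X n)

/-- `dc (P n 1) ≤ 2n` (`hasDetRepr_rankPer_one`; `dc` is the least size of an affine
determinantal representation, Mignon–Ressayre 2004, §1). [folklore] -/
theorem dc_rankPer_one_le (n : ℕ) :
    determinantalComplexity (aeval (fun x : Fin n × Fin n => ∑ a : Fin 1,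
      (X (Sum.inl (x.1, a)) * X (Sum.inr (x.2, a)) :
        MvPolynomial ((Fin n × Fin 1) ⊕ (Fin n × Fin 1)) ℂ))
      (perPoly (Fin n) ℂ)) ≤ 2 * n := by
  rw [two_mul]
  exact determinantalComplexity_le_of_hasDetRepr (hasDetRepr_rankPer_one n)

/-- **The rank-one rung is exactly tight: `dc (P n 1) = 2n`** — the degree floor
`2n ≤ dc (P n r)` of the line (`ChowRankDegreeFloor.two_mul_le_dc_rankPer`, Mignon–Ressayre 2004,
§1: `deg f ≤ dc f`) meets the diagonal representation `dc (P n 1) ≤ 2n` (`dc_rankPer_one_le`).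
So at rank one the determinantal complexity of the rank-`r` permanent equals its number of
variables `2nr`, and nothing of Kumar–Volk type (a bound `> #vars`) can hold there. [folklore] -/
theorem dc_rankPer_one : ∀ n : ℕ,
    determinantalComplexity (aeval (fun x : Fin n × Fin n => ∑ a : Fin 1,
      (X (Sum.inl (x.1, a)) * X (Sum.inr (x.2, a)) :
        MvPolynomial ((Fin n × Fin 1) ⊕ (Fin n × Fin 1)) ℂ))
      (perPoly (Fin n) ℂ)) = 2 * n :=
  fun n => le_antisymm (dc_rankPer_one_le n) (two_mul_le_dc_rankPer n 1 le_rfl)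

/-- **The Kumar–Volk rung fails at rank one**: for every `k` and every `n ≥ 1`,
`¬ (k + 1) · (2 · n · 1) ≤ k · dc (P n 1)`, since `dc (P n 1) = 2n` (`dc_rankPer_one`) and
`k · 2n < (k + 1) · 2n`.  (The registered `stub_kvRung` quantifies `∃ r ≥ 1`; this lemma shows
the instance `r = 1` of its matrix is false, so a witness needs `r ≥ 2`, `two_le_of_kvRung`.)
[folklore] -/
theorem not_kvRung_rank_one (k n : ℕ) (hn : 1 ≤ n) :
    ¬ (k + 1) * (2 * n * 1) ≤ k * determinantalComplexity (aeval (fun x : Fin n × Fin n =>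
      ∑ a : Fin 1, (X (Sum.inl (x.1, a)) * X (Sum.inr (x.2, a)) :
        MvPolynomial ((Fin n × Fin 1) ⊕ (Fin n × Fin 1)) ℂ))
      (perPoly (Fin n) ℂ)) := by
  rw [dc_rankPer_one n, not_le]
  nlinarith

/-- **Every witness of the Kumar–Volk rung has rank `r ≥ 2`.**  If `1 ≤ r` and
`(k + 1) · 2nr ≤ k · dc (P n r)` for all `n ≥ n₀`, then `r ≠ 1` (`not_kvRung_rank_one` at
`n = max n₀ 1`), so `2 ≤ r`: the rung is a statement about `P n r` for some `r ≥ 2`, where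
`dc (P n 2) ∈ [2n, n² + 2n]` is all that is known. [folklore] -/
theorem two_le_of_kvRung {r k n₀ : ℕ} (hr : 1 ≤ r)
    (h : ∀ n : ℕ, n₀ ≤ n →
      (k + 1) * (2 * n * r) ≤ k * determinantalComplexity (aeval (fun x : Fin n × Fin n =>
        ∑ a : Fin r, (X (Sum.inl (x.1, a)) * X (Sum.inr (x.2, a)) :
          MvPolynomial ((Fin n × Fin r) ⊕ (Fin n × Fin r)) ℂ))
        (perPoly (Fin n) ℂ))) :
    2 ≤ r := by
  by_contra hlt
  obtain rfl : r = 1 := by omega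
  exact not_kvRung_rank_one k (max n₀ 1) (le_max_right _ _) (h (max n₀ 1) (le_max_left _ _))

end Summit.ValiantsHypothesis.ValiantsHypothesis.Theorems.DetQPDetqpThesis.ChowRankKvRung

end
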